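import Literature.AlgebraicGeometry.Motives.StandardConjecturesKunnethProofs
import Literature.AlgebraicGeometry.Motives.CorrespondencesAlgebraicOperators
import Literature.AlgebraicGeometry.Motives.LefschetzLambdaProofs
import Literature.AlgebraicGeometry.Motives.LefschetzDecompositionProofs
import HarnessLib

/-!
# The standard conjecture of Lefschetz type: `B(X) ⇔ Λ algebraic` (proof)

`Literature.AlgebraicGeometry.Motives.StandardConjectures` records as a named fact (D-0014), among
the classical relations between Grothendieck's standard conjectures (item hodge.S29), the
equivalence `standardConjectureB_iff_standardConjectureBΛ`: for a Weil cohomology theory `W` with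
the hard Lefschetz property, a smooth projective `X` of dimension `n` and a hyperplane class
`η ∈ H²(X)`, the `θ`-form of `B(X, η)` (the inverses `θⁱ` of the hard-Lefschetz isomorphisms
`Lⁿ⁻ⁱ : Hⁱ(X) ⥲ H²ⁿ⁻ⁱ(X)` are induced by algebraic correspondences with `ℚ`-coefficients) is
equivalent to the `Λ`-form (Kleiman's operator `Λ` is induced by algebraic correspondences) —
S. Kleiman, *Algebraic cycles and the Weil conjectures* (1968), §2, Prop. 2.3; S. Kleiman, *The
standard conjectures* (1994), §4, Thm 4-1; J. Murre, *Lectures on motives* (2004), §4.2.1.2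
(`B(X)`: "`Λ` is algebraic", with the reference to [Kl68], [Kl94] for the equivalent forms).

This file **proves** it (`standardConjectureB_iff_standardConjectureBΛ_holds`), formally in the
axioms of `Literature.AlgebraicGeometry.Motives.WeilCohomology`, on top of the discharged facts
`isAlgebraicGradedOp_comp_holds` (`CorrespondencesCompProofs`: composites of algebraic
correspondences are algebraic), `exists_isLambdaOp` and `lefschetz_induction`
(`LefschetzLambdaProofs`, `LefschetzStarProofs`: existence of `Λ` and the spanning half of the
Lefschetz decomposition), `exists_isAlgebraicGradedOp_lefschetzPow` (`StandardConjecturesKunnethProofs`: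
the graded Lefschetz operator `Lᵐ` is algebraic) and the additivity of inducedness
(`CorrespondencesAlgebraicOperators`). The companion fact `B(X) ⇒ C(X)`
(`standardConjectureC_of_standardConjectureB_holds`) is proved in `StandardConjecturesKunnethProofs`;
here its `Λ`-analogue `Λ algebraic ⇒ C(X)` (`isAlgebraicOperator_id_of_isLambdaOp`) is the main
intermediate step. No statement of `StandardConjectures.lean` is restated or modified; no new named
fact is introduced (the new `def`s are auxiliary graded operators and degree predicates).

## Proof architecture (Kleiman 1968 §1.4, §2)

Throughout, "algebraic" for a graded operator `T : H•(X) → H•(X)` is `W.IsAlgebraicGradedOp n n T`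
(every component on a line `j = i + 2c - 2n` is induced by one rational algebraic class
`u_c ∈ Aᶜ(X × X)_ℚ`, Kleiman's pairing form), and `[θ]` denotes the graded operator
`GradedOp.ofLinearMap θ` with a single nonzero component.

1. *Calculus of graded operators* (`PreWeilCohomology.GradedOp.…`): components of composites with a
   single surviving middle degree; operators raising / lowering degrees by a fixed amount and
   diagonal operators (`IsRaisingBy`, `IsLoweringBy`, `IsDiag`) and their composites. Algebraic
   graded operators are stable under sums and differences (`IsAlgebraicGradedOp.add`, `.neg`, `.sub`,
   `isAlgebraicGradedOp_sum`: sums of the inducing correspondences).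
2. *The Lefschetz operators* (Kleiman 1968 §1.4): the graded operator `Lᵐ` (`lefschetzGrPow`, all
   degrees at once) is algebraic for `η ∈ A¹(X)_ℚ` (`isAlgebraicGradedOp_lefschetzGrPow`, from
   `exists_isAlgebraicGradedOp_lefschetzPow`), `L⁰ = id` also directly by the class `δ` of the
   diagonal; graded powers `Tᵐ` (`gradedPow`, with `T⁰ = L⁰`, cast-free) of an algebraic `T` are
   algebraic by `isAlgebraicGradedOp_comp_holds`.
3. *`B ⇒ Λ algebraic`* (Kleiman 1968, proof of Prop. 2.3; hard Lefschetz): `Λ` is the finite sum of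
   its components `[Λ_{q+2,q}]` (`eq_sum_ofLinearMap_of_isLoweringBy_two`), and by the characterisation
   `Λ x = 0`, `Λ Lʲ⁺¹ x = Lʲ x` on primitive `x` together with `lefschetz_induction`,
   `Λ_{q+2,q} = θ ∘ Lˢ` for `q + 2 ≤ n + 1` (`lambdaOp_low_eq`, `θ` the inverse of `Lˢ⁺¹`,
   `q + s + 1 = n`) and `Λ_{q+2,q} = Lᵉ⁺¹ ∘ θ` for `q = n + e ≥ n` (`lambdaOp_high_eq`, `θ` the inverse
   of `Lᵉ⁺²`; this is Murre's description `Λ ∘ Lᵉ⁺² = Lᵉ⁺¹`, LNM 1594 §7.7); each summand is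
   `[θ] ∘ Lˢ` or `Lᵉ⁺¹ ∘ [θ]` (`ofLinearMap_comp_lefschetzGrPow`, `lefschetzGrPow_comp_ofLinearMap`),
   hence algebraic.
4. *`Λ algebraic ⇒ B`* (Kleiman 1968 Prop. 2.3 with the projector calculus of §1.4; hard Lefschetz):
   on the Lefschetz summands `Lᵇ Pᵃ(X)` (`x ∈ Pᵃ` primitive, `a + b ≤ n`) one has
   `Λᵐ Lᵇ⁺ᵐ x = Lᵇ x` and `Λᵐ Lᵇ x = 0` for `b < m` (`gradedPow_apply_lefschetzPow_of_isLambdaOp`,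
   `gradedPow_apply_lefschetzPow_eq_zero_of_lt`), so `Λᵐ Lᵐ` is the projector onto the summands of
   level `a + b ≤ n - m` and `Lᵗ Λᵗ` the projector onto those of height `b ≥ t`; the differences
   `Uₘ = ΛᵐLᵐ - Λᵐ⁺¹Lᵐ⁺¹`, `Vₜ = LᵗΛᵗ - Lᵗ⁺¹Λᵗ⁺¹` single out level `n - m` and height `t`, and
   `πⁱ = Σₜ Vₜ ∘ U_{n+t-i}` (`kunnethPoly`, `kunnethPoly_eq_ofLinearMap_id` by `lefschetz_induction`)
   is a non-commutative polynomial in `L` and `Λ`, hence algebraic (`Λ ⇒ C`,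
   `isAlgebraicOperator_id_of_isLambdaOp`). Finally the inverse of `Lʳ : Hⁱ ⥲ Hⁱ⁺²ʳ` (`i + r = n`) is
   the component `(Λʳ)_{i+2r,i}` and `[(Λʳ)_{i+2r,i}] = πⁱ ∘ Λʳ` is algebraic
   (`standardConjectureB_of_standardConjectureBΛ`).

All degree bookkeeping is by explicit equations (`h : i + 2 * r = j`), as in the rest of the trunk
(no `ℕ`-subtraction in statements except the summation index `n + t - i` of `kunnethPoly`, guarded
by the filter `i ≤ n + t`).

## References

* S. Kleiman, *Algebraic cycles and the Weil conjectures*, in: Dix exposés sur la cohomologie des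
  schémas, North-Holland (1968), 359–386: §1.3 (correspondences), §1.4 (1.4.1 Lefschetz
  decomposition, 1.4.2 the operators `Λ`, `⋆`), §2 (conjectures of Lefschetz type, Prop. 2.3).
  [Kleiman1968AlgebraicCycles]
* S. Kleiman, *The standard conjectures*, in: Motives (Seattle 1991), Proc. Sympos. Pure Math. 55
  Part 1 (1994), 3–20, §4, Thm 4-1. [Kleiman1994StandardConjectures]
* J. P. Murre, *Lectures on motives*, in: Transcendental Aspects of Algebraic Cycles (Grenoble 2001),
  LMS Lecture Note Ser. 313 (2004), §4.2.1.2 (held; PDF p. 135: `B(X)`: "`Λ` is algebraic",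
  (c) "`B(X) ⇒ C(X)`", referring to [Kl68], [Kl94] for the equivalent forms). [Murre2004LecturesMotives]
* J. P. Murre, *Algebraic cycles and algebraic aspects of cohomology and K-theory*, in: Algebraic
  Cycles and Hodge Theory (Torino 1993), LNM 1594 (1994), §7.7 (held; PDF pp. 122–123: the Lefschetz
  standard conjecture "the operator `Λ` is algebraic"). [MurreTorino1994]
-/

universe u v

open CategoryTheory AlgebraicGeometry MonoidalCategory CartesianMonoidalCategory
open scoped TensorProduct

noncomputable section

namespace Literature.AlgebraicGeometry.Motives

/-! ## Graded operators: components of composites, pure degrees -/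

namespace PreWeilCohomology

variable {k : Type u} [Field k] {K : Type v} [Field K] (W : PreWeilCohomology k K)
variable {X Y Z : SchemeOver k}

namespace GradedOp

variable {W}

/-- A component of a composite of graded operators with a single surviving middle degree `m₀`
(all other components of the first factor out of `Hⁱ(X)` vanish). [folklore] -/
lemma comp_apply_of_source_vanish (S : W.GradedOp Y Z) (T : W.GradedOp X Y) {i j : ℕ} (m₀ : ℕ)
    (hT : ∀ m, m ≠ m₀ → T i m = 0) : S.comp T i j = S m₀ j ∘ₗ T i m₀ :=
  finsum_eq_single (fun m ↦ (S m j).comp (T i m)) m₀ fun m hm ↦ by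
    rw [hT m hm, LinearMap.comp_zero]

/-- A component of a composite of graded operators with a single surviving middle degree `m₀`
(all other components of the second factor into `Hʲ(Z)` vanish). [folklore] -/
lemma comp_apply_of_target_vanish (S : W.GradedOp Y Z) (T : W.GradedOp X Y) {i j : ℕ} (m₀ : ℕ)
    (hS : ∀ m, m ≠ m₀ → S m j = 0) : S.comp T i j = S m₀ j ∘ₗ T i m₀ :=
  finsum_eq_single (fun m ↦ (S m j).comp (T i m)) m₀ fun m hm ↦ by
    rw [hS m hm, LinearMap.zero_comp]

/-- A component of a composite of graded operators all of whose summands vanish is zero. [folklore] -/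
lemma comp_apply_eq_zero (S : W.GradedOp Y Z) (T : W.GradedOp X Y) {i j : ℕ}
    (h : ∀ m, S m j ∘ₗ T i m = 0) : S.comp T i j = 0 := by
  show ∑ᶠ m, (S m j).comp (T i m) = 0
  simp only [h, finsum_zero]

/-- A graded operator *raises degrees by exactly `d`*: its components `Hⁱ → Hʲ` with `j ≠ i + d`
vanish (e.g. the iterated Lefschetz operator `Lᵐ`, `d = 2m`). [folklore] -/
def IsRaisingBy (T : W.GradedOp X Y) (d : ℕ) : Prop :=
  ∀ i j : ℕ, i + d ≠ j → T i j = 0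

/-- A graded operator *lowers degrees by exactly `d`*: its components `Hⁱ → Hʲ` with `i ≠ j + d`
vanish (e.g. Kleiman's `Λ`, `d = 2`, and its powers). [folklore] -/
def IsLoweringBy (T : W.GradedOp X Y) (d : ℕ) : Prop :=
  ∀ i j : ℕ, j + d ≠ i → T i j = 0

/-- A graded operator is *diagonal*: its components `Hⁱ → Hʲ` with `i ≠ j` vanish. [folklore] -/
def IsDiag (T : W.GradedOp X Y) : Prop :=
  ∀ i j : ℕ, i ≠ j → T i j = 0

/-- Component of `S ∘ T` when `T` raises degrees by `d`: `(S ∘ T)ᵢⱼ = Sₘⱼ ∘ Tᵢₘ`, `m = i + d`. [folklore] -/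
lemma IsRaisingBy.comp_apply {T : W.GradedOp X Y} {d : ℕ} (hT : IsRaisingBy T d)
    (S : W.GradedOp Y Z) (i j m : ℕ) (hm : i + d = m) : S.comp T i j = S m j ∘ₗ T i m :=
  comp_apply_of_source_vanish S T m fun m' hm' ↦ hT i m' (by omega)

/-- Component of `S ∘ T` when `T` lowers degrees by `d`: `(S ∘ T)ᵢⱼ = Sₘⱼ ∘ Tᵢₘ`, `m + d = i`. [folklore] -/
lemma IsLoweringBy.comp_apply {T : W.GradedOp X Y} {d : ℕ} (hT : IsLoweringBy T d)
    (S : W.GradedOp Y Z) (i j m : ℕ) (hm : m + d = i) : S.comp T i j = S m j ∘ₗ T i m :=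
  comp_apply_of_source_vanish S T m fun m' hm' ↦ hT i m' (by omega)

/-- Component of `S ∘ T` when `T` lowers degrees by `d` out of a degree `i < d`: zero. [folklore] -/
lemma IsLoweringBy.comp_apply_eq_zero {T : W.GradedOp X Y} {d : ℕ} (hT : IsLoweringBy T d)
    (S : W.GradedOp Y Z) (i j : ℕ) (hi : i < d) : S.comp T i j = 0 :=
  GradedOp.comp_apply_eq_zero S T fun m ↦ by rw [hT i m (by omega), LinearMap.comp_zero]

/-- Component of `S ∘ T` when `S` raises degrees by `e`: `(S ∘ T)ᵢⱼ = Sₘⱼ ∘ Tᵢₘ`, `m + e = j`. [folklore] -/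
lemma IsRaisingBy.comp_apply' {S : W.GradedOp Y Z} {e : ℕ} (hS : IsRaisingBy S e)
    (T : W.GradedOp X Y) (i j m : ℕ) (hm : m + e = j) : S.comp T i j = S m j ∘ₗ T i m :=
  comp_apply_of_target_vanish S T m fun m' hm' ↦ hS m' j (by omega)

/-- Component of `S ∘ T` when `S` raises degrees by `e` into a degree `j < e`: zero. [folklore] -/
lemma IsRaisingBy.comp_apply_eq_zero' {S : W.GradedOp Y Z} {e : ℕ} (hS : IsRaisingBy S e)
    (T : W.GradedOp X Y) (i j : ℕ) (hj : j < e) : S.comp T i j = 0 :=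
  GradedOp.comp_apply_eq_zero S T fun m ↦ by rw [hS m j (by omega), LinearMap.zero_comp]

/-- Component of `S ∘ T` when `S` lowers degrees by `e`: `(S ∘ T)ᵢⱼ = Sₘⱼ ∘ Tᵢₘ`, `j + e = m`. [folklore] -/
lemma IsLoweringBy.comp_apply' {S : W.GradedOp Y Z} {e : ℕ} (hS : IsLoweringBy S e)
    (T : W.GradedOp X Y) (i j m : ℕ) (hm : j + e = m) : S.comp T i j = S m j ∘ₗ T i m :=
  comp_apply_of_target_vanish S T m fun m' hm' ↦ hS m' j (by omega)

/-- Component of `S ∘ T` when `T` is diagonal: `(S ∘ T)ᵢⱼ = Sᵢⱼ ∘ Tᵢᵢ`. [folklore] -/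
lemma IsDiag.comp_apply {T : W.GradedOp X Y} (hT : IsDiag T) (S : W.GradedOp Y Z) (i j : ℕ) :
    S.comp T i j = S i j ∘ₗ T i i :=
  comp_apply_of_source_vanish S T i fun m hm ↦ hT i m (Ne.symm hm)

/-- Composites of degree-raising operators raise degrees by the sum. [folklore] -/
lemma IsRaisingBy.comp {S : W.GradedOp Y Z} {T : W.GradedOp X Y} {d e : ℕ} (hS : IsRaisingBy S e)
    (hT : IsRaisingBy T d) : IsRaisingBy (S.comp T) (d + e) := by
  intro i j hij
  refine GradedOp.comp_apply_eq_zero S T fun m ↦ ?_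
  by_cases h : i + d = m
  · rw [hS m j (by omega), LinearMap.zero_comp]
  · rw [hT i m h, LinearMap.comp_zero]

/-- Composites of degree-lowering operators lower degrees by the sum. [folklore] -/
lemma IsLoweringBy.comp {S : W.GradedOp Y Z} {T : W.GradedOp X Y} {d e : ℕ}
    (hS : IsLoweringBy S e) (hT : IsLoweringBy T d) : IsLoweringBy (S.comp T) (d + e) := by
  intro i j hij
  refine GradedOp.comp_apply_eq_zero S T fun m ↦ ?_
  by_cases h : m + d = i
  · rw [hS m j (by omega), LinearMap.zero_comp]
  · rw [hT i m h, LinearMap.comp_zero]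

/-- `S ∘ T` is diagonal when `T` raises and `S` lowers degrees by the same amount. [folklore] -/
lemma IsLoweringBy.comp_isRaisingBy {S : W.GradedOp Y Z} {T : W.GradedOp X Y} {d : ℕ}
    (hS : IsLoweringBy S d) (hT : IsRaisingBy T d) : IsDiag (S.comp T) := by
  intro i j hij
  refine GradedOp.comp_apply_eq_zero S T fun m ↦ ?_
  by_cases h : i + d = m
  · rw [hS m j (by omega), LinearMap.zero_comp]
  · rw [hT i m h, LinearMap.comp_zero]

/-- `S ∘ T` is diagonal when `T` lowers and `S` raises degrees by the same amount. [folklore] -/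
lemma IsRaisingBy.comp_isLoweringBy {S : W.GradedOp Y Z} {T : W.GradedOp X Y} {d : ℕ}
    (hS : IsRaisingBy S d) (hT : IsLoweringBy T d) : IsDiag (S.comp T) := by
  intro i j hij
  refine GradedOp.comp_apply_eq_zero S T fun m ↦ ?_
  by_cases h : m + d = i
  · rw [hS m j (by omega), LinearMap.zero_comp]
  · rw [hT i m h, LinearMap.comp_zero]

/-- Composites of diagonal operators are diagonal. [folklore] -/
lemma IsDiag.comp {S : W.GradedOp Y Z} {T : W.GradedOp X Y} (hS : IsDiag S) (hT : IsDiag T) :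
    IsDiag (S.comp T) := by
  intro i j hij
  rw [hT.comp_apply S i j, hS i j hij, LinearMap.zero_comp]

/-- Sums of diagonal operators are diagonal. [folklore] -/
lemma IsDiag.add {S T : W.GradedOp X Y} (hS : IsDiag S) (hT : IsDiag T) : IsDiag (S + T) :=
  fun i j hij ↦ by rw [Pi.add_apply, Pi.add_apply, hS i j hij, hT i j hij, add_zero]

/-- Differences of diagonal operators are diagonal. [folklore] -/
lemma IsDiag.sub {S T : W.GradedOp X Y} (hS : IsDiag S) (hT : IsDiag T) : IsDiag (S - T) :=
  fun i j hij ↦ by rw [Pi.sub_apply, Pi.sub_apply, hS i j hij, hT i j hij, sub_zero]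

/-- Finite sums of diagonal operators are diagonal. [folklore] -/
lemma isDiag_sum {ι : Type*} (s : Finset ι) (G : ι → W.GradedOp X Y) (h : ∀ t ∈ s, IsDiag (G t)) :
    IsDiag (∑ t ∈ s, G t) := by
  intro i j hij
  rw [Finset.sum_apply, Finset.sum_apply]
  exact Finset.sum_eq_zero fun t ht ↦ h t ht i j hij

/-- A component of a finite sum of graded operators. [folklore] -/
lemma sum_apply₂ {ι : Type*} (s : Finset ι) (G : ι → W.GradedOp X Y) (i j : ℕ) :
    (∑ t ∈ s, G t) i j = ∑ t ∈ s, G t i j := by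
  rw [Finset.sum_apply, Finset.sum_apply]

end GradedOp

/-! ## Algebraic graded operators form a subgroup -/

section Algebraic

/-- Inducedness is compatible with negation. [folklore] -/
lemma IsInducedBy.neg {nX nY : ℕ} {m i j j' : ℕ} {hj : j + j' = 2 * nY}
    {hm : i + m + j' = 2 * (nX + nY)} {u : W.obj (X ⊗ Y) m}
    {T : W.obj X i →ₗ[K] W.obj Y j} (h : W.IsInducedBy nX nY u T hj hm) :
    W.IsInducedBy nX nY (-u) (-T) hj hm := by
  intro x y
  simp only [LinearMap.neg_apply, map_neg, h x y]

variable (X Y) in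
/-- The zero graded operator is algebraic (induced by the zero correspondences); a `PreWeilCohomology`
-level private copy of `WeilCohomology.isAlgebraicGradedOp_zero` (`StandardConjecturesKunnethProofs`). [folklore] -/
private lemma isAlgebraicGradedOp_zero (nX nY : ℕ) :
    W.IsAlgebraicGradedOp nX nY (0 : W.GradedOp X Y) :=
  ⟨fun _ ↦ 0, fun _ _ _ _ _ _ _ ↦ W.isInducedBy_zero, fun _ _ _ ↦ rfl⟩

/-- Sums of algebraic graded operators are algebraic (sum of the inducing correspondences). [folklore] -/
lemma IsAlgebraicGradedOp.add {nX nY : ℕ} {S T : W.GradedOp X Y}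
    (hS : W.IsAlgebraicGradedOp nX nY S) (hT : W.IsAlgebraicGradedOp nX nY T) :
    W.IsAlgebraicGradedOp nX nY (S + T) := by
  obtain ⟨u, hu, hu0⟩ := hS
  obtain ⟨v, hv, hv0⟩ := hT
  refine ⟨fun c ↦ u c + v c, fun i j c j' hj hm hc ↦ ?_, fun i j hij ↦ ?_⟩
  · simpa only [Pi.add_apply, AddSubgroup.coe_add] using
      (hu i j c j' hj hm hc).add (hv i j c j' hj hm hc)
  · rw [Pi.add_apply, Pi.add_apply, hu0 i j hij, hv0 i j hij, add_zero]

/-- Negatives of algebraic graded operators are algebraic. [folklore] -/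
lemma IsAlgebraicGradedOp.neg {nX nY : ℕ} {T : W.GradedOp X Y}
    (hT : W.IsAlgebraicGradedOp nX nY T) : W.IsAlgebraicGradedOp nX nY (-T) := by
  obtain ⟨u, hu, hu0⟩ := hT
  refine ⟨fun c ↦ -u c, fun i j c j' hj hm hc ↦ ?_, fun i j hij ↦ ?_⟩
  · simpa only [Pi.neg_apply, AddSubgroup.coe_neg] using (hu i j c j' hj hm hc).neg W
  · rw [Pi.neg_apply, Pi.neg_apply, hu0 i j hij, neg_zero]

/-- Differences of algebraic graded operators are algebraic. [folklore] -/
lemma IsAlgebraicGradedOp.sub {nX nY : ℕ} {S T : W.GradedOp X Y}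
    (hS : W.IsAlgebraicGradedOp nX nY S) (hT : W.IsAlgebraicGradedOp nX nY T) :
    W.IsAlgebraicGradedOp nX nY (S - T) := by
  rw [sub_eq_add_neg]
  exact hS.add W (hT.neg W)

/-- Finite sums of algebraic graded operators are algebraic. [folklore] -/
lemma isAlgebraicGradedOp_sum {nX nY : ℕ} {ι : Type*} (s : Finset ι) (G : ι → W.GradedOp X Y)
    (h : ∀ t ∈ s, W.IsAlgebraicGradedOp nX nY (G t)) :
    W.IsAlgebraicGradedOp nX nY (∑ t ∈ s, G t) := by
  classical
  induction s using Finset.induction_on with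
  | empty => simpa only [Finset.sum_empty] using W.isAlgebraicGradedOp_zero X Y nX nY
  | insert a s ha ih =>
    rw [Finset.sum_insert ha]
    exact (h a (Finset.mem_insert_self a s)).add W
      (ih fun t ht ↦ h t (Finset.mem_insert_of_mem ht))

end Algebraic

/-! ## The graded iterated Lefschetz operators and graded powers -/

section LefschetzGr

variable (X)

/-- The iterated Lefschetz operator `Lᵐ = (· ∪ ηᵐ)` as a graded operator `H•(X) → H•(X)`: the
component `Hⁱ → Hⁱ⁺²ᵐ` is `W.lefschetzPow X η m`, all other components vanish (Kleiman 1968 §1.4;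
for `m = 1` this is `W.lefschetzOp X η`, for `m = 0` it is the identity in each degree, as `x ↦ x ∪ 1`). [cite: Kleiman1968AlgebraicCycles, §1.4] -/
def lefschetzGrPow (η : W.obj X 2) (m : ℕ) : W.GradedOp X X :=
  fun i j ↦ if h : i + 2 * m = j then W.lefschetzPow X η m i j h else 0

/-- Graded powers of a graded operator `T : H•(X) → H•(X)`: `T⁰ = L⁰` (the identity in each degree,
written as `x ↦ x ∪ η⁰ = x ∪ 1` to stay cast-free) and `Tᵐ⁺¹ = Tᵐ ∘ T`. [folklore] -/
def gradedPow (η : W.obj X 2) (T : W.GradedOp X X) : ℕ → W.GradedOp X X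
  | 0 => W.lefschetzGrPow X η 0
  | m + 1 => (gradedPow η T m).comp T

variable {X}

/-- The component `Hⁱ → Hⁱ⁺²ᵐ` of the graded `Lᵐ` is `lefschetzPow`. [folklore] -/
lemma lefschetzGrPow_apply (η : W.obj X 2) (m : ℕ) {i j : ℕ} (h : i + 2 * m = j) :
    W.lefschetzGrPow X η m i j = W.lefschetzPow X η m i j h :=
  dif_pos h

/-- The components `Hⁱ → Hʲ`, `j ≠ i + 2m`, of the graded `Lᵐ` vanish. [folklore] -/
lemma lefschetzGrPow_of_ne (η : W.obj X 2) (m : ℕ) {i j : ℕ} (h : i + 2 * m ≠ j) :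
    W.lefschetzGrPow X η m i j = 0 :=
  dif_neg h

/-- The graded `Lᵐ` raises degrees by `2m`. [folklore] -/
lemma isRaisingBy_lefschetzGrPow (η : W.obj X 2) (m : ℕ) :
    GradedOp.IsRaisingBy (W.lefschetzGrPow X η m) (2 * m) :=
  fun _ _ h ↦ dif_neg h

/-- `T⁰ = L⁰`. [folklore] -/
@[simp]
lemma gradedPow_zero (η : W.obj X 2) (T : W.GradedOp X X) :
    W.gradedPow X η T 0 = W.lefschetzGrPow X η 0 :=
  rfl

/-- `Tᵐ⁺¹ = Tᵐ ∘ T`. [folklore] -/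
lemma gradedPow_succ (η : W.obj X 2) (T : W.GradedOp X X) (m : ℕ) :
    W.gradedPow X η T (m + 1) = (W.gradedPow X η T m).comp T :=
  rfl

end LefschetzGr

end PreWeilCohomology

/-! ## Algebraicity of the Lefschetz operators -/

namespace WeilCohomology

variable {k : Type u} [Field k] {K : Type v} [Field K] [CharZero K] (W : WeilCohomology k K)
variable {n : ℕ} {X : SchemeOver k}

/-- A hyperplane class is a rational algebraic class, `η = ι* cl(D) ∈ A¹(X)_ℚ`
(`cycleMap_mem_algebraicLattice`, `pullback_ratAlgebraicClasses_le`,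
`isSmoothProjective_projectiveSpace_holds`; Kleiman 1968 §1.4). Private copy of
`WeilCohomology.mem_ratAlgebraicClasses_of_isHyperplaneClass` (`MotivatedCyclesProofs`), kept
local to avoid that import. [cite: Kleiman1968AlgebraicCycles, §1.4] -/
private theorem hyperplaneClass_mem_ratAlgebraicClasses (hX : IsSmoothProjective n X)
    {η : W.obj X 2} (hη : W.IsHyperplaneClass X η) : η ∈ W.ratAlgebraicClasses X 1 := by
  obtain ⟨e, D, hD, -, rfl⟩ := hη
  exact W.pullback_ratAlgebraicClasses_le hX (isSmoothProjective_projectiveSpace_holds k e.n) e.ι 1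
    ⟨_, W.algebraicLattice_le_ratAlgebraicClasses _ 1 (W.cycleMap_mem_algebraicLattice _ 1 hD), rfl⟩

/-- **The graded Lefschetz operators `Lᵐ` are algebraic** for `η ∈ A¹(X)_ℚ` (Kleiman 1968 §1.4:
`L` is induced by the algebraic correspondence `Δ₊ η`): `Lᵐ` in every degree at once is induced
by `pr₁* ηᵐ ∪ δ ∈ Aⁿ⁺ᵐ(X × X)_ℚ`, `δ` the class inducing the identity — this is
`exists_isAlgebraicGradedOp_lefschetzPow` of `StandardConjecturesKunnethProofs`, whose graded
operator is `lefschetzGrPow`. [cite: Kleiman1968AlgebraicCycles, §1.4] -/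
theorem isAlgebraicGradedOp_lefschetzGrPow (hX : IsSmoothProjective n X) {η : W.obj X 2}
    (hη : η ∈ W.ratAlgebraicClasses X 1) (m : ℕ) :
    W.IsAlgebraicGradedOp n n (W.lefschetzGrPow X η m) := by
  obtain ⟨T, hT, hT₀, hTa⟩ := W.exists_isAlgebraicGradedOp_lefschetzPow hX hη m
  have hTL : T = W.lefschetzGrPow X η m := by
    funext a b
    by_cases h : a + 2 * m = b
    · rw [hT h, W.lefschetzGrPow_apply η m h]
    · rw [hT₀ h, W.lefschetzGrPow_of_ne η m h]
  rw [← hTL]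
  exact hTa

/-- **The identity graded operator `L⁰` is algebraic**, induced by the class `δ ∈ Aⁿ(X × X)_ℚ` of
the diagonal in every degree (`exists_isInducedBy_id`; Kleiman 1968 §1.3, `Δ` induces the
identity). [cite: Kleiman1968AlgebraicCycles, §1.3] -/
theorem isAlgebraicGradedOp_lefschetzGrPow_zero (hX : IsSmoothProjective n X) (η : W.obj X 2) :
    W.IsAlgebraicGradedOp n n (W.lefschetzGrPow X η 0) := by
  classical
  obtain ⟨δ, hδ, hδi⟩ := W.exists_isInducedBy_id hX
  refine ⟨fun c ↦ if hc : n = c then ⟨hc ▸ δ, by subst hc; exact hδ⟩ else 0, ?_, ?_⟩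
  · intro i j c j' hj hm' hline
    by_cases hc : n = c
    · subst hc
      obtain rfl : i = j := by omega
      simp only [W.lefschetzGrPow_apply η 0 (show i + 2 * 0 = i by omega), W.lefschetzPow_zero hX η]
      exact hδi i j' hj
    · have h : i + 2 * 0 ≠ j := fun h ↦ hc (by omega)
      simp only [dif_neg hc, ZeroMemClass.coe_zero, W.lefschetzGrPow_of_ne η 0 h]
      exact W.isInducedBy_zero
  · intro i j hne
    exact W.lefschetzGrPow_of_ne η 0 fun h ↦ hne ⟨n, by omega⟩

/-- **Graded powers of an algebraic graded operator are algebraic** (`isAlgebraicGradedOp_comp_holds`,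
Kleiman 1968 §1.3). [cite: Kleiman1968AlgebraicCycles, §1.3] -/
theorem isAlgebraicGradedOp_gradedPow (hX : IsSmoothProjective n X) (η : W.obj X 2)
    {T : W.GradedOp X X} (hT : W.IsAlgebraicGradedOp n n T) :
    ∀ m : ℕ, W.IsAlgebraicGradedOp n n (W.gradedPow X η T m)
  | 0 => W.isAlgebraicGradedOp_lefschetzGrPow_zero hX η
  | m + 1 => W.isAlgebraicGradedOp_comp_holds hX hX hX (isAlgebraicGradedOp_gradedPow hX η hT m) hT

/-! ## Single components and compositions with `Lᵐ` -/

section OfLinearMap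

variable {η : W.obj X 2}

/-- `[θ] ∘ Lˢ = [θ ∘ Lˢ]` for the graded operator `[θ]` with single component `θ : Hʲ → Hⁱ`
(`j = p + 2s`): the composite is again concentrated in one bidegree
(`GradedOp.ofLinearMap_comp_of_lefschetzPow` of `StandardConjecturesKunnethProofs` for `lefschetzGrPow`). [folklore] -/
theorem ofLinearMap_comp_lefschetzGrPow {i j : ℕ} (θ : W.obj X j →ₗ[K] W.obj X i) (s p : ℕ)
    (hp : p + 2 * s = j) :
    (PreWeilCohomology.GradedOp.ofLinearMap θ).comp (W.lefschetzGrPow X η s) =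
      PreWeilCohomology.GradedOp.ofLinearMap (θ ∘ₗ W.lefschetzPow X η s p j hp) :=
  PreWeilCohomology.GradedOp.ofLinearMap_comp_of_lefschetzPow η s
    (fun _ _ h ↦ W.lefschetzGrPow_apply η s h) (fun _ _ h ↦ W.lefschetzGrPow_of_ne η s h) θ hp

/-- `Lˢ ∘ [θ] = [Lˢ ∘ θ]` for the graded operator `[θ]` with single component `θ : Hʲ → Hⁱ`
(`q = i + 2s`; `GradedOp.comp_ofLinearMap_of_lefschetzPow` for `lefschetzGrPow`). [folklore] -/
theorem lefschetzGrPow_comp_ofLinearMap {i j : ℕ} (θ : W.obj X j →ₗ[K] W.obj X i) (s q : ℕ)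
    (hq : i + 2 * s = q) :
    (W.lefschetzGrPow X η s).comp (PreWeilCohomology.GradedOp.ofLinearMap θ) =
      PreWeilCohomology.GradedOp.ofLinearMap (W.lefschetzPow X η s i q hq ∘ₗ θ) :=
  PreWeilCohomology.GradedOp.comp_ofLinearMap_of_lefschetzPow η s
    (fun _ _ h ↦ W.lefschetzGrPow_apply η s h) (fun _ _ h ↦ W.lefschetzGrPow_of_ne η s h) θ hq

/-- `[id_{Hⁱ}] ∘ T = [T_{p,i}]` for a graded operator `T` lowering degrees by `d`, `p = i + d`:
composing with the degree-`i` projector isolates the single component of `T` into `Hⁱ`. [folklore] -/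
theorem ofLinearMap_id_comp_of_isLoweringBy {T : W.GradedOp X X} {d : ℕ}
    (hT : PreWeilCohomology.GradedOp.IsLoweringBy T d) (i p : ℕ) (hp : i + d = p) :
    (PreWeilCohomology.GradedOp.ofLinearMap (LinearMap.id : W.obj X i →ₗ[K] W.obj X i)).comp T =
      PreWeilCohomology.GradedOp.ofLinearMap (T p i) := by
  funext a b
  by_cases hb : i = b
  · subst hb
    rw [PreWeilCohomology.GradedOp.comp_apply_of_target_vanish _ T i fun m hm ↦
        PreWeilCohomology.GradedOp.ofLinearMap_apply_of_ne _ fun h ↦ hm h.1.symm,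
      PreWeilCohomology.GradedOp.ofLinearMap_apply_same, LinearMap.id_comp]
    by_cases ha : p = a
    · subst ha
      rw [PreWeilCohomology.GradedOp.ofLinearMap_apply_same]
    · rw [PreWeilCohomology.GradedOp.ofLinearMap_apply_of_ne _ fun h ↦ ha h.1, hT a i (by omega)]
  · rw [PreWeilCohomology.GradedOp.ofLinearMap_apply_of_ne _ fun h ↦ hb h.2]
    exact PreWeilCohomology.GradedOp.comp_apply_eq_zero _ T fun m ↦ by
      rw [PreWeilCohomology.GradedOp.ofLinearMap_apply_of_ne _ fun h ↦ hb h.2, LinearMap.zero_comp]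

/-- A graded operator lowering degrees by `2` and vanishing out of degrees `> N` is the (finite) sum
of its single components `T_{q+2,q}`, `q + 2 ≤ N`. [folklore] -/
theorem eq_sum_ofLinearMap_of_isLoweringBy_two {T : W.GradedOp X X}
    (hT : PreWeilCohomology.GradedOp.IsLoweringBy T 2) (N : ℕ) (hN : ∀ p q, N < p → T p q = 0) :
    T = ∑ q ∈ Finset.range (N - 1), PreWeilCohomology.GradedOp.ofLinearMap (T (q + 2) q) := by
  funext p q
  rw [PreWeilCohomology.GradedOp.sum_apply₂]
  by_cases hp : q + 2 = p
  · subst hp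
    by_cases hq : q < N - 1
    · rw [Finset.sum_eq_single_of_mem q (Finset.mem_range.mpr hq) fun b _ hbq ↦
        PreWeilCohomology.GradedOp.ofLinearMap_apply_of_ne _ fun h ↦ hbq h.2,
        PreWeilCohomology.GradedOp.ofLinearMap_apply_same]
    · rw [Finset.sum_eq_zero fun b hb ↦ PreWeilCohomology.GradedOp.ofLinearMap_apply_of_ne _
        fun h ↦ hq (by obtain ⟨-, h2⟩ := h; subst h2; exact Finset.mem_range.mp hb)]
      exact hN (q + 2) q (by omega)
  · rw [hT p q hp, Finset.sum_eq_zero fun b _ ↦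
      PreWeilCohomology.GradedOp.ofLinearMap_apply_of_ne _ fun h ↦ hp (by omega)]

end OfLinearMap

/-! ## `B(X) ⇒ Λ algebraic` -/

section BLambda

variable {η : W.obj X 2}

/-- The components of `Λ` in degrees `a = b + 2 ≤ n + 1`: `Λ_{a,b} = θ ∘ Lˢ` with `a + s = n + 1`
and `θ` the inverse of `Lˢ⁺¹ : Hᵇ ⥲ Hᵃ⁺²ˢ` (Kleiman 1968 1.4.2 / proof of Prop. 2.3: both sides kill
`Pᵃ` and send `Lʲ⁺¹ x ↦ Lʲ x`; `lefschetz_induction`). [cite: Kleiman1968AlgebraicCycles, §1.4 (1.4.2) and Prop. 2.3] -/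
theorem lambdaOp_low_eq (hL : W.HasHardLefschetz) (hX : IsSmoothProjective n X)
    (hη : W.IsHyperplaneClass X η) {Λ : W.GradedOp X X} (hΛ : W.IsLambdaOp n η Λ) {b s : ℕ}
    (hs : b + s + 1 = n) {h₂ : b + 2 * (s + 1) = b + 2 + 2 * s}
    {θ : W.obj X (b + 2 + 2 * s) →ₗ[K] W.obj X b} (hθ : W.IsLefschetzTheta n η (s + 1) h₂ θ) :
    Λ (b + 2) b = θ ∘ₗ W.lefschetzPow X η s (b + 2) (b + 2 + 2 * s) rfl := by
  refine LinearMap.ext fun y ↦ W.lefschetz_induction hL hX hη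
    (C := fun y ↦ Λ (b + 2) b y = (θ ∘ₗ W.lefschetzPow X η s (b + 2) (b + 2 + 2 * s) rfl) y)
    ?_ ?_ ?_ y
  · simp only [map_zero]
  · intro y z hy hz
    simp only [map_add, hy, hz]
  · intro i j h x hx hij
    rw [LinearMap.comp_apply]
    rcases j with _ | j
    · obtain rfl : i = b + 2 := by omega
      rw [W.lefschetzPow_zero hX η, LinearMap.id_apply, hΛ.2.1 _ x hx b,
        W.lefschetzPow_eq_zero_of_isPrimitive hX η hx rfl (by omega), map_zero]
    · rw [hΛ.2.2 i x hx j (b + 2) b h (by omega) hij,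
        W.lefschetzPow_lefschetzPow hX η (show (j + 1) + s = j + (s + 1) by omega) h rfl
          (show i + 2 * (j + (s + 1)) = b + 2 + 2 * s by omega) x,
        ← W.lefschetzPow_lefschetzPow hX η (rfl : j + (s + 1) = j + (s + 1))
          (show i + 2 * j = b by omega) h₂ (show i + 2 * (j + (s + 1)) = b + 2 + 2 * s by omega) x,
        ← LinearMap.comp_apply (f := θ), hθ.2.1, LinearMap.id_apply]

/-- The components of `Λ` in degrees `a = n + e + 2 ≥ n + 2`: `Λ_{a,a-2} = Lᵉ⁺¹ ∘ θ` with `θ` the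
inverse of `Lᵉ⁺² : Hᶜ ⥲ Hᵃ`, `c + e + 2 = n` (Kleiman 1968 1.4.2 / proof of Prop. 2.3; Murre's
description `Λ ∘ Lᵉ⁺² = Lᵉ⁺¹` on `Hᶜ`; `lefschetz_induction`). [cite: Kleiman1968AlgebraicCycles, §1.4 (1.4.2) and Prop. 2.3] -/
theorem lambdaOp_high_eq (hL : W.HasHardLefschetz) (hX : IsSmoothProjective n X)
    (hη : W.IsHyperplaneClass X η) {Λ : W.GradedOp X X} (hΛ : W.IsLambdaOp n η Λ) {c e : ℕ}
    (hc : c + e + 2 = n) {h₂ : c + 2 * (e + 2) = n + e + 2}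
    {θ : W.obj X (n + e + 2) →ₗ[K] W.obj X c} (hθ : W.IsLefschetzTheta n η (e + 2) h₂ θ)
    (hh : c + 2 * (e + 1) = n + e) :
    Λ (n + e + 2) (n + e) = W.lefschetzPow X η (e + 1) c (n + e) hh ∘ₗ θ := by
  refine LinearMap.ext fun y ↦ W.lefschetz_induction hL hX hη
    (C := fun y ↦ Λ (n + e + 2) (n + e) y = (W.lefschetzPow X η (e + 1) c (n + e) hh ∘ₗ θ) y)
    ?_ ?_ ?_ y
  · simp only [map_zero]
  · intro y z hy hz
    simp only [map_add, hy, hz]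
  · intro i j h x hx hij
    obtain ⟨d, rfl⟩ : ∃ d, j = d + e + 1 + 1 := ⟨j - e - 2, by omega⟩
    rw [LinearMap.comp_apply, hΛ.2.2 i x hx (d + e + 1) _ _ h (show i + 2 * (d + e + 1) = n + e by omega) hij,
      ← W.lefschetzPow_lefschetzPow hX η (show d + (e + 2) = d + e + 1 + 1 by omega)
        (show i + 2 * d = c by omega) h₂ h x,
      ← LinearMap.comp_apply (f := θ), hθ.2.1, LinearMap.id_apply,
      W.lefschetzPow_lefschetzPow hX η (show d + (e + 1) = d + e + 1 by omega) _ hh _ x]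

/-- **`B(X) ⇒ Λ algebraic`** (Kleiman 1968 Prop. 2.3, (θ) ⇒ (Λ); Kleiman 1994 Thm 4-1): under hard
Lefschetz, if the inverses `θ` of the `Lⁿ⁻ⁱ` are algebraic then Kleiman's `Λ` is: `Λ` is the finite sum
of its components `Λ_{q+2,q}`, each of which is `[θ] ∘ Lˢ` (`q + 2 ≤ n + 1`) or `Lᵉ⁺¹ ∘ [θ]`
(`q + 2 ≥ n + 2`), composites of algebraic graded operators. [cite: Kleiman1968AlgebraicCycles, §2 Prop. 2.3] -/
theorem standardConjectureBΛ_of_standardConjectureB (hL : W.HasHardLefschetz)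
    (hX : IsSmoothProjective n X) (hη : W.IsHyperplaneClass X η) (hB : W.StandardConjectureB n X η) :
    W.StandardConjectureBΛ n X η := by
  intro Λ hΛ
  have hηa := W.hyperplaneClass_mem_ratAlgebraicClasses hX hη
  have hN : ∀ p q : ℕ, 2 * n < p → Λ p q = 0 := fun p q hp ↦ by
    haveI := W.subsingleton_obj hX hp
    ext x
    rw [Subsingleton.elim x 0, map_zero, LinearMap.zero_apply]
  rw [W.eq_sum_ofLinearMap_of_isLoweringBy_two hΛ.1 (2 * n) hN]
  refine W.isAlgebraicGradedOp_sum _ _ fun q hq ↦ ?_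
  rw [Finset.mem_range] at hq
  by_cases hqn : q < n
  · obtain ⟨s, hs⟩ : ∃ s, q + s + 1 = n := ⟨n - 1 - q, by omega⟩
    obtain ⟨θ, hθ, hθa⟩ := hB q (s + 1) (q + 2 + 2 * s) (by omega) (by omega)
    rw [W.lambdaOp_low_eq hL hX hη hΛ hs hθ, ← W.ofLinearMap_comp_lefschetzGrPow θ s (q + 2) rfl]
    exact W.isAlgebraicGradedOp_comp_holds hX hX hX hθa (W.isAlgebraicGradedOp_lefschetzGrPow hX hηa s)
  · obtain ⟨e, rfl⟩ : ∃ e, q = n + e := ⟨q - n, by omega⟩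
    obtain ⟨c, hc⟩ : ∃ c, c + e + 2 = n := ⟨n - e - 2, by omega⟩
    obtain ⟨θ, hθ, hθa⟩ := hB c (e + 2) (n + e + 2) (by omega) (by omega)
    rw [W.lambdaOp_high_eq hL hX hη hΛ hc hθ (by omega),
      ← W.lefschetzGrPow_comp_ofLinearMap θ (e + 1) (n + e) (by omega)]
    exact W.isAlgebraicGradedOp_comp_holds hX hX hX (W.isAlgebraicGradedOp_lefschetzGrPow hX hηa _) hθa

end BLambda

/-! ## Powers of `Λ` on the Lefschetz summands -/

section LambdaPow

variable {η : W.obj X 2} {Λ : W.GradedOp X X}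

/-- Kleiman's `Λ` lowers degrees by `2` (first clause of `IsLambdaOp`). [folklore] -/
theorem isLoweringBy_of_isLambdaOp (hΛ : W.IsLambdaOp n η Λ) :
    PreWeilCohomology.GradedOp.IsLoweringBy Λ 2 :=
  hΛ.1

/-- `Λᵐ` lowers degrees by `2m`. [folklore] -/
theorem isLoweringBy_gradedPow_of_isLambdaOp (hΛ : W.IsLambdaOp n η Λ) :
    ∀ m : ℕ, PreWeilCohomology.GradedOp.IsLoweringBy (W.gradedPow X η Λ m) (2 * m)
  | 0 => fun _ _ h ↦ W.lefschetzGrPow_of_ne η 0 (by omega)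
  | m + 1 => fun i j h ↦
    ((isLoweringBy_gradedPow_of_isLambdaOp hΛ m).comp (W.isLoweringBy_of_isLambdaOp hΛ)) i j (by omega)

/-- **`Λᵐ Lˢ x = Lˢ⁻ᵐ x` on the Lefschetz summands** (Kleiman 1968 1.4.2 iterated): for `x ∈ Pᵃ(X)`
primitive, `t + m = s` and `a + s ≤ n`, `Λᵐ (Lˢ x) = Lᵗ x`. [cite: Kleiman1968AlgebraicCycles, §1.4 (1.4.2)] -/
theorem gradedPow_apply_lefschetzPow_of_isLambdaOp (hX : IsSmoothProjective n X)
    (hΛ : W.IsLambdaOp n η Λ) {a : ℕ} {x : W.obj X a} (hx : W.IsPrimitive n η x) :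
    ∀ (m t s d₁ d₂ : ℕ) (_ : t + m = s) (h₁ : a + 2 * s = d₁) (h₂ : a + 2 * t = d₂), a + s ≤ n →
      W.gradedPow X η Λ m d₁ d₂ (W.lefschetzPow X η s a d₁ h₁ x) = W.lefschetzPow X η t a d₂ h₂ x
  | 0, t, s, d₁, d₂, hs, h₁, h₂, _ => by
    obtain rfl : s = t := by omega
    have hd : d₁ + 2 * 0 = d₂ := by omega
    rw [W.gradedPow_zero, W.lefschetzGrPow_apply η 0 hd]
    exact W.lefschetzPow_lefschetzPow hX η (show s + 0 = s by omega) h₁ hd h₂ x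
  | m + 1, t, s, d₁, d₂, hs, h₁, h₂, hle => by
    obtain rfl : s = t + m + 1 := by omega
    rw [W.gradedPow_succ, (W.isLoweringBy_of_isLambdaOp hΛ).comp_apply _ d₁ d₂ (a + 2 * (t + m)) (by omega),
      LinearMap.comp_apply, hΛ.2.2 a x hx (t + m) d₁ (a + 2 * (t + m)) h₁ rfl (by omega)]
    exact gradedPow_apply_lefschetzPow_of_isLambdaOp hX hΛ hx m t (t + m) _ d₂ rfl rfl h₂ (by omega)

/-- **`Λᵐ Lᵇ x = 0` for `b < m`** on the Lefschetz summands (`x ∈ Pᵃ(X)` primitive): `Λ` kills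
primitive classes (Kleiman 1968 1.4.2). [cite: Kleiman1968AlgebraicCycles, §1.4 (1.4.2)] -/
theorem gradedPow_apply_lefschetzPow_eq_zero_of_lt (hX : IsSmoothProjective n X)
    (hΛ : W.IsLambdaOp n η Λ) {a : ℕ} {x : W.obj X a} (hx : W.IsPrimitive n η x) :
    ∀ (m b d₁ d₂ : ℕ) (h₁ : a + 2 * b = d₁), b < m →
      W.gradedPow X η Λ m d₁ d₂ (W.lefschetzPow X η b a d₁ h₁ x) = 0
  | 0, _, _, _, _, hb => absurd hb (Nat.not_lt_zero _)
  | m + 1, 0, d₁, d₂, h₁, _ => by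
    obtain rfl : a = d₁ := by omega
    rw [W.lefschetzPow_zero hX η, LinearMap.id_apply, W.gradedPow_succ]
    by_cases ha : a < 2
    · rw [(W.isLoweringBy_of_isLambdaOp hΛ).comp_apply_eq_zero _ a d₂ ha, LinearMap.zero_apply]
    · obtain ⟨m₀, hm₀⟩ : ∃ m₀, m₀ + 2 = a := ⟨a - 2, by omega⟩
      rw [(W.isLoweringBy_of_isLambdaOp hΛ).comp_apply _ a d₂ m₀ hm₀, LinearMap.comp_apply,
        hΛ.2.1 a x hx m₀, map_zero]
  | m + 1, b + 1, d₁, d₂, h₁, hb => by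
    rw [W.gradedPow_succ, (W.isLoweringBy_of_isLambdaOp hΛ).comp_apply _ d₁ d₂ (a + 2 * b) (by omega),
      LinearMap.comp_apply]
    by_cases hle : a + (b + 1) ≤ n
    · rw [hΛ.2.2 a x hx b d₁ (a + 2 * b) h₁ rfl hle]
      exact gradedPow_apply_lefschetzPow_eq_zero_of_lt hX hΛ hx m b _ d₂ rfl (by omega)
    · rw [W.lefschetzPow_eq_zero_of_isPrimitive hX η hx h₁ (by omega), map_zero, map_zero]

end LambdaPow

/-! ## The degree projectors as polynomials in `L` and `Λ` -/

section Projectors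

variable (X)

/-- `Λᵐ ∘ Lᵐ`: on the Lefschetz summand `Lᵇ Pᵃ(X)` it is the identity if `a + b + m ≤ n` and zero
otherwise (`lowerRaise_apply_lefschetzPow`). [folklore] -/
def lowerRaise (η : W.obj X 2) (Λ : W.GradedOp X X) (m : ℕ) : W.GradedOp X X :=
  (W.gradedPow X η Λ m).comp (W.lefschetzGrPow X η m)

/-- `Lᵗ ∘ Λᵗ`: on the Lefschetz summand `Lᵇ Pᵃ(X)` it is the identity if `t ≤ b` and zero
otherwise (`raiseLower_apply_lefschetzPow`). [folklore] -/
def raiseLower (η : W.obj X 2) (Λ : W.GradedOp X X) (t : ℕ) : W.GradedOp X X :=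
  (W.lefschetzGrPow X η t).comp (W.gradedPow X η Λ t)

/-- `Λᵐ Lᵐ - Λᵐ⁺¹ Lᵐ⁺¹`: the projector onto the Lefschetz summands `Lᵇ Pᵃ(X)` of *level*
`a + b = n - m` (Kleiman 1968 §1.4 and §2, proof of Prop. 2.3: the projectors of the Lefschetz
decomposition are non-commutative polynomials in `L` and `Λ`). [cite: Kleiman1968AlgebraicCycles, §1.4 and §2 Prop. 2.3] -/
def levelProjector (η : W.obj X 2) (Λ : W.GradedOp X X) (m : ℕ) : W.GradedOp X X :=
  W.lowerRaise X η Λ m - W.lowerRaise X η Λ (m + 1)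

/-- `Lᵗ Λᵗ - Lᵗ⁺¹ Λᵗ⁺¹`: the projector onto the Lefschetz summands `Lᵇ Pᵃ(X)` of *height* `b = t`. [cite: Kleiman1968AlgebraicCycles, §1.4 and §2 Prop. 2.3] -/
def heightProjector (η : W.obj X 2) (Λ : W.GradedOp X X) (t : ℕ) : W.GradedOp X X :=
  W.raiseLower X η Λ t - W.raiseLower X η Λ (t + 1)

/-- **The Künneth projector `πⁱ` as a non-commutative polynomial in `L` and `Λ`**
(Kleiman 1968 §1.4 and §2, proof of Prop. 2.3; Kleiman 1994 §4): `πⁱ = Σₜ Vₜ ∘ U_{n+t-i}` over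
`t ≤ i ≤ n + t`, `Vₜ` the height-`t` and `Uₘ` the level-`(n - m)` projector, since the summand
`Lᵇ Pᵃ(X)` lies in degree `i = a + 2b` iff its height `b = t` and level `a + b = i - t`. [cite: Kleiman1968AlgebraicCycles, §1.4 and §2 Prop. 2.3] -/
def kunnethPoly (n : ℕ) (η : W.obj X 2) (Λ : W.GradedOp X X) (i : ℕ) : W.GradedOp X X :=
  ∑ t ∈ (Finset.range (n + 1)).filter (fun t ↦ t ≤ i ∧ i ≤ n + t),
    (W.heightProjector X η Λ t).comp (W.levelProjector X η Λ (n + t - i))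

variable {X}
variable {η : W.obj X 2} {Λ : W.GradedOp X X}

/-- `Λᵐ Lᵐ` is diagonal. [folklore] -/
theorem isDiag_lowerRaise (hΛ : W.IsLambdaOp n η Λ) (m : ℕ) :
    PreWeilCohomology.GradedOp.IsDiag (W.lowerRaise X η Λ m) :=
  (W.isLoweringBy_gradedPow_of_isLambdaOp hΛ m).comp_isRaisingBy (W.isRaisingBy_lefschetzGrPow η m)

/-- `Lᵗ Λᵗ` is diagonal. [folklore] -/
theorem isDiag_raiseLower (hΛ : W.IsLambdaOp n η Λ) (t : ℕ) :
    PreWeilCohomology.GradedOp.IsDiag (W.raiseLower X η Λ t) :=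
  (W.isRaisingBy_lefschetzGrPow η t).comp_isLoweringBy (W.isLoweringBy_gradedPow_of_isLambdaOp hΛ t)

/-- The level projectors are diagonal. [folklore] -/
theorem isDiag_levelProjector (hΛ : W.IsLambdaOp n η Λ) (m : ℕ) :
    PreWeilCohomology.GradedOp.IsDiag (W.levelProjector X η Λ m) :=
  (W.isDiag_lowerRaise hΛ m).sub (W.isDiag_lowerRaise hΛ (m + 1))

/-- The height projectors are diagonal. [folklore] -/
theorem isDiag_heightProjector (hΛ : W.IsLambdaOp n η Λ) (t : ℕ) :
    PreWeilCohomology.GradedOp.IsDiag (W.heightProjector X η Λ t) :=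
  (W.isDiag_raiseLower hΛ t).sub (W.isDiag_raiseLower hΛ (t + 1))

/-- The polynomial `πⁱ` is diagonal. [folklore] -/
theorem isDiag_kunnethPoly (hΛ : W.IsLambdaOp n η Λ) (i : ℕ) :
    PreWeilCohomology.GradedOp.IsDiag (W.kunnethPoly X n η Λ i) :=
  PreWeilCohomology.GradedOp.isDiag_sum _ _ fun t _ ↦
    (W.isDiag_heightProjector hΛ t).comp (W.isDiag_levelProjector hΛ _)

/-- `Λᵐ Lᵐ (Lᵇ x) = Lᵇ x` if `a + b + m ≤ n`, and `= 0` otherwise, for `x ∈ Pᵃ(X)` primitive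
(`Lᵇ⁺ᵐ x = 0` in the second case). [folklore] -/
theorem lowerRaise_apply_lefschetzPow (hX : IsSmoothProjective n X) (hΛ : W.IsLambdaOp n η Λ)
    {a : ℕ} {x : W.obj X a} (hx : W.IsPrimitive n η x) (m b d : ℕ) (h : a + 2 * b = d) :
    W.lowerRaise X η Λ m d d (W.lefschetzPow X η b a d h x) =
      if a + b + m ≤ n then W.lefschetzPow X η b a d h x else 0 := by
  rw [lowerRaise, (W.isRaisingBy_lefschetzGrPow η m).comp_apply _ d d (d + 2 * m) rfl,
    LinearMap.comp_apply, W.lefschetzGrPow_apply η m rfl,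
    W.lefschetzPow_lefschetzPow hX η (rfl : b + m = b + m) h rfl (show a + 2 * (b + m) = d + 2 * m by omega) x]
  split_ifs with hle
  · exact W.gradedPow_apply_lefschetzPow_of_isLambdaOp hX hΛ hx m b (b + m) _ d rfl _ h (by omega)
  · rw [W.lefschetzPow_eq_zero_of_isPrimitive hX η hx _ (by omega), map_zero]

/-- The level projector `Uₘ` is the identity on `Lᵇ Pᵃ(X)` if `a + b + m = n` and zero otherwise. [folklore] -/
theorem levelProjector_apply_lefschetzPow (hX : IsSmoothProjective n X) (hΛ : W.IsLambdaOp n η Λ)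
    {a : ℕ} {x : W.obj X a} (hx : W.IsPrimitive n η x) (m b d : ℕ) (h : a + 2 * b = d) :
    W.levelProjector X η Λ m d d (W.lefschetzPow X η b a d h x) =
      if a + b + m = n then W.lefschetzPow X η b a d h x else 0 := by
  rw [levelProjector, Pi.sub_apply, Pi.sub_apply, LinearMap.sub_apply,
    W.lowerRaise_apply_lefschetzPow hX hΛ hx m b d h,
    W.lowerRaise_apply_lefschetzPow hX hΛ hx (m + 1) b d h]
  split_ifs <;> first | (exfalso; omega) | simp

/-- `Lᵗ Λᵗ (Lᵇ x) = Lᵇ x` if `t ≤ b`, and `= 0` otherwise, for `x ∈ Pᵃ(X)` primitive. [folklore] -/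
theorem raiseLower_apply_lefschetzPow (hX : IsSmoothProjective n X) (hΛ : W.IsLambdaOp n η Λ)
    {a : ℕ} {x : W.obj X a} (hx : W.IsPrimitive n η x) (t b d : ℕ) (h : a + 2 * b = d)
    (hab : a + b ≤ n) :
    W.raiseLower X η Λ t d d (W.lefschetzPow X η b a d h x) =
      if t ≤ b then W.lefschetzPow X η b a d h x else 0 := by
  by_cases htb : t ≤ b
  · obtain ⟨b', rfl⟩ : ∃ b', b = b' + t := ⟨b - t, by omega⟩
    rw [if_pos htb, raiseLower,
      (W.isRaisingBy_lefschetzGrPow η t).comp_apply' _ d d (a + 2 * b') (by omega), LinearMap.comp_apply,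
      W.gradedPow_apply_lefschetzPow_of_isLambdaOp hX hΛ hx t b' (b' + t) d (a + 2 * b') rfl h rfl
        (by omega),
      W.lefschetzGrPow_apply η t (show a + 2 * b' + 2 * t = d by omega),
      W.lefschetzPow_lefschetzPow hX η (rfl : b' + t = b' + t) rfl (show a + 2 * b' + 2 * t = d by omega)
        h x]
  · rw [if_neg htb, raiseLower]
    by_cases hd : d < 2 * t
    · rw [(W.isRaisingBy_lefschetzGrPow η t).comp_apply_eq_zero' _ d d hd, LinearMap.zero_apply]
    · obtain ⟨m₀, hm₀⟩ : ∃ m₀, m₀ + 2 * t = d := ⟨d - 2 * t, by omega⟩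
      rw [(W.isRaisingBy_lefschetzGrPow η t).comp_apply' _ d d m₀ hm₀, LinearMap.comp_apply,
        W.gradedPow_apply_lefschetzPow_eq_zero_of_lt hX hΛ hx t b d m₀ h (by omega), map_zero]

/-- The height projector `Vₜ` is the identity on `Lᵇ Pᵃ(X)` if `b = t` and zero otherwise. [folklore] -/
theorem heightProjector_apply_lefschetzPow (hX : IsSmoothProjective n X) (hΛ : W.IsLambdaOp n η Λ)
    {a : ℕ} {x : W.obj X a} (hx : W.IsPrimitive n η x) (t b d : ℕ) (h : a + 2 * b = d)
    (hab : a + b ≤ n) :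
    W.heightProjector X η Λ t d d (W.lefschetzPow X η b a d h x) =
      if b = t then W.lefschetzPow X η b a d h x else 0 := by
  rw [heightProjector, Pi.sub_apply, Pi.sub_apply, LinearMap.sub_apply,
    W.raiseLower_apply_lefschetzPow hX hΛ hx t b d h hab,
    W.raiseLower_apply_lefschetzPow hX hΛ hx (t + 1) b d h hab]
  split_ifs <;> first | (exfalso; omega) | simp

/-- `Vₜ ∘ Uₘ` is the identity on `Lᵇ Pᵃ(X)` if `b = t` and `a + b + m = n`, and zero otherwise. [folklore] -/
theorem heightProjector_comp_levelProjector_apply (hX : IsSmoothProjective n X)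
    (hΛ : W.IsLambdaOp n η Λ) {a : ℕ} {x : W.obj X a} (hx : W.IsPrimitive n η x) (t m b d : ℕ)
    (h : a + 2 * b = d) (hab : a + b ≤ n) :
    (W.heightProjector X η Λ t).comp (W.levelProjector X η Λ m) d d (W.lefschetzPow X η b a d h x) =
      if b = t ∧ a + b + m = n then W.lefschetzPow X η b a d h x else 0 := by
  rw [(W.isDiag_levelProjector hΛ m).comp_apply _ d d, LinearMap.comp_apply,
    W.levelProjector_apply_lefschetzPow hX hΛ hx m b d h]
  by_cases hm : a + b + m = n
  · rw [if_pos hm, W.heightProjector_apply_lefschetzPow hX hΛ hx t b d h hab]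
    by_cases hbt : b = t
    · rw [if_pos hbt, if_pos ⟨hbt, hm⟩]
    · rw [if_neg hbt, if_neg fun h' ↦ hbt h'.1]
  · rw [if_neg hm, map_zero, if_neg fun h' ↦ hm h'.2]

/-- **`πⁱ` on the Lefschetz summands**: the polynomial `kunnethPoly i` is the identity on `Lᵇ Pᵃ(X)`
if `a + 2b = i` and zero otherwise (Kleiman 1968 §2, proof of Prop. 2.3). [cite: Kleiman1968AlgebraicCycles, §1.4 and §2 Prop. 2.3] -/
theorem kunnethPoly_apply_lefschetzPow (hX : IsSmoothProjective n X) (hΛ : W.IsLambdaOp n η Λ)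
    {a : ℕ} {x : W.obj X a} (hx : W.IsPrimitive n η x) (i b d : ℕ) (h : a + 2 * b = d)
    (hab : a + b ≤ n) :
    W.kunnethPoly X n η Λ i d d (W.lefschetzPow X η b a d h x) =
      if a + 2 * b = i then W.lefschetzPow X η b a d h x else 0 := by
  rw [kunnethPoly, PreWeilCohomology.GradedOp.sum_apply₂, LinearMap.sum_apply,
    Finset.sum_congr rfl fun t _ ↦
      W.heightProjector_comp_levelProjector_apply hX hΛ hx t (n + t - i) b d h hab]
  by_cases hi : a + 2 * b = i
  · have hb : b ∈ (Finset.range (n + 1)).filter (fun t ↦ t ≤ i ∧ i ≤ n + t) := by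
      simp only [Finset.mem_filter, Finset.mem_range]
      omega
    rw [if_pos hi, Finset.sum_eq_single_of_mem b hb fun t _ htb ↦ if_neg fun h' ↦ htb h'.1.symm,
      if_pos ⟨rfl, by omega⟩]
  · rw [if_neg hi]
    refine Finset.sum_eq_zero fun t ht ↦ if_neg ?_
    simp only [Finset.mem_filter, Finset.mem_range] at ht
    omega

/-- **`πⁱ` is a polynomial in `L` and `Λ`** (Kleiman 1968 §2, proof of Prop. 2.3; Kleiman 1994 §4): under hard
Lefschetz the graded operator `kunnethPoly i` *is* the degree-`i` projector `[id_{Hⁱ}]`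
(componentwise, by `lefschetz_induction` from `kunnethPoly_apply_lefschetzPow`). [cite: Kleiman1968AlgebraicCycles, §1.4 and §2 Prop. 2.3] -/
theorem kunnethPoly_eq_ofLinearMap_id (hL : W.HasHardLefschetz) (hX : IsSmoothProjective n X)
    (hη : W.IsHyperplaneClass X η) (hΛ : W.IsLambdaOp n η Λ) (i : ℕ) :
    W.kunnethPoly X n η Λ i =
      PreWeilCohomology.GradedOp.ofLinearMap (LinearMap.id : W.obj X i →ₗ[K] W.obj X i) := by
  funext p q
  by_cases hpq : p = q
  · subst hpq
    refine LinearMap.ext fun y ↦ W.lefschetz_induction hL hX hη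
      (C := fun y ↦ W.kunnethPoly X n η Λ i p p y =
        PreWeilCohomology.GradedOp.ofLinearMap (LinearMap.id : W.obj X i →ₗ[K] W.obj X i) p p y)
      ?_ ?_ ?_ y
    · simp only [map_zero]
    · intro y z hy hz
      simp only [map_add, hy, hz]
    · intro i' j h x hx hij
      rw [W.kunnethPoly_apply_lefschetzPow hX hΛ hx i j p h hij]
      by_cases hpi : i = p
      · subst hpi
        rw [PreWeilCohomology.GradedOp.ofLinearMap_apply_same, LinearMap.id_apply, if_pos h]
      · rw [PreWeilCohomology.GradedOp.ofLinearMap_apply_of_ne _ fun h' ↦ hpi h'.1,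
          LinearMap.zero_apply, if_neg fun h' ↦ hpi (by omega)]
  · rw [W.isDiag_kunnethPoly hΛ i p q hpq,
      PreWeilCohomology.GradedOp.ofLinearMap_apply_of_ne _ fun h ↦ hpq (h.1.symm.trans h.2)]

/-- `πⁱ = kunnethPoly i` is algebraic when `Λ` is (and `η ∈ A¹(X)_ℚ`): sums, differences and
composites of the algebraic graded operators `Lᵐ`, `Λᵐ`. [cite: Kleiman1968AlgebraicCycles, §2 Prop. 2.3] -/
theorem isAlgebraicGradedOp_kunnethPoly (hX : IsSmoothProjective n X)
    (hη : η ∈ W.ratAlgebraicClasses X 1) (hΛ : W.IsAlgebraicGradedOp n n Λ) (i : ℕ) :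
    W.IsAlgebraicGradedOp n n (W.kunnethPoly X n η Λ i) := by
  have hLR : ∀ m, W.IsAlgebraicGradedOp n n (W.lowerRaise X η Λ m) := fun m ↦
    W.isAlgebraicGradedOp_comp_holds hX hX hX (W.isAlgebraicGradedOp_gradedPow hX η hΛ m)
      (W.isAlgebraicGradedOp_lefschetzGrPow hX hη m)
  have hRL : ∀ t, W.IsAlgebraicGradedOp n n (W.raiseLower X η Λ t) := fun t ↦
    W.isAlgebraicGradedOp_comp_holds hX hX hX (W.isAlgebraicGradedOp_lefschetzGrPow hX hη t)
      (W.isAlgebraicGradedOp_gradedPow hX η hΛ t)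
  exact W.isAlgebraicGradedOp_sum _ _ fun t _ ↦ W.isAlgebraicGradedOp_comp_holds hX hX hX
    ((hRL t).sub _ (hRL (t + 1))) ((hLR _).sub _ (hLR _))

end Projectors

/-! ## `Λ algebraic ⇒ C(X)` and `Λ algebraic ⇒ B(X)` -/

section LambdaB

variable {η : W.obj X 2}

/-- **`Λ algebraic ⇒ C(X)`** (Kleiman 1968 §2, Prop. 2.3 and its proof; Kleiman 1994 §4, Thm 4-1;
Murre 2004 §4.2.1.2 (c)):
under hard Lefschetz, if Kleiman's `Λ` is algebraic then every Künneth projector `πⁱ = [id_{Hⁱ}]`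
is algebraic, being the polynomial `kunnethPoly i` in `L` and `Λ`. [cite: Kleiman1968AlgebraicCycles, §2 Prop. 2.3] -/
theorem isAlgebraicOperator_id_of_isLambdaOp (hL : W.HasHardLefschetz) (hX : IsSmoothProjective n X)
    (hη : W.IsHyperplaneClass X η) {Λ : W.GradedOp X X} (hΛ : W.IsLambdaOp n η Λ)
    (hΛa : W.IsAlgebraicGradedOp n n Λ) (i : ℕ) :
    W.IsAlgebraicOperator n n (LinearMap.id : W.obj X i →ₗ[K] W.obj X i) := by
  show W.IsAlgebraicGradedOp n n (PreWeilCohomology.GradedOp.ofLinearMap LinearMap.id)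
  rw [← W.kunnethPoly_eq_ofLinearMap_id hL hX hη hΛ i]
  exact W.isAlgebraicGradedOp_kunnethPoly hX (W.hyperplaneClass_mem_ratAlgebraicClasses hX hη)
    hΛa i

/-- **`Λ algebraic ⇒ B(X)` in `θ`-form** (Kleiman 1968 Prop. 2.3, (Λ) ⇒ (θ); Kleiman 1994 Thm 4-1):
under hard Lefschetz, the inverse of `Lʳ : Hⁱ ⥲ Hʲ` (`i + r = n`, `j = i + 2r`) is the component
`(Λʳ)_{j,i}` (`Λʳ Lᵇ⁺ʳ x = Lᵇ x` on the Lefschetz summands), and `[(Λʳ)_{j,i}] = πⁱ ∘ Λʳ` is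
algebraic when `Λ` is. [cite: Kleiman1968AlgebraicCycles, §2 Prop. 2.3] -/
theorem standardConjectureB_of_standardConjectureBΛ (hL : W.HasHardLefschetz)
    (hX : IsSmoothProjective n X) (hη : W.IsHyperplaneClass X η) (hBΛ : W.StandardConjectureBΛ n X η) :
    W.StandardConjectureB n X η := by
  obtain ⟨Λ, hΛ⟩ := W.exists_isLambdaOp hL hX hη
  have hΛa := hBΛ Λ hΛ
  intro i r j hir h₂
  refine ⟨W.gradedPow X η Λ r j i, ⟨hir, ?_, ?_⟩, ?_⟩
  · refine LinearMap.ext fun y ↦ W.lefschetz_induction hL hX hη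
      (C := fun y ↦ (W.gradedPow X η Λ r j i ∘ₗ W.lefschetzPow X η r i j h₂) y = LinearMap.id y)
      ?_ ?_ ?_ y
    · simp only [map_zero]
    · intro y z hy hz
      simp only [map_add, hy, hz]
    · intro a b h x hx hab
      rw [LinearMap.comp_apply, LinearMap.id_apply,
        W.lefschetzPow_lefschetzPow hX η (rfl : b + r = b + r) h h₂ (show a + 2 * (b + r) = j by omega) x]
      exact W.gradedPow_apply_lefschetzPow_of_isLambdaOp hX hΛ hx r b (b + r) j i rfl _ h (by omega)
  · refine LinearMap.ext fun y ↦ W.lefschetz_induction hL hX hη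
      (C := fun y ↦ (W.lefschetzPow X η r i j h₂ ∘ₗ W.gradedPow X η Λ r j i) y = LinearMap.id y)
      ?_ ?_ ?_ y
    · simp only [map_zero]
    · intro y z hy hz
      simp only [map_add, hy, hz]
    · intro a b h x hx hab
      obtain ⟨t, rfl⟩ : ∃ t, b = t + r := ⟨b - r, by omega⟩
      rw [LinearMap.comp_apply, LinearMap.id_apply,
        W.gradedPow_apply_lefschetzPow_of_isLambdaOp hX hΛ hx r t (t + r) j i rfl h
          (show a + 2 * t = i by omega) (by omega)]
      exact W.lefschetzPow_lefschetzPow hX η (rfl : t + r = t + r) _ h₂ h x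
  · show W.IsAlgebraicGradedOp n n (PreWeilCohomology.GradedOp.ofLinearMap (W.gradedPow X η Λ r j i))
    rw [← W.ofLinearMap_id_comp_of_isLoweringBy (W.isLoweringBy_gradedPow_of_isLambdaOp hΛ r) i j
      (by omega)]
    exact W.isAlgebraicGradedOp_comp_holds hX hX hX (W.isAlgebraicOperator_id_of_isLambdaOp hL hX hη hΛ hΛa i)
      (W.isAlgebraicGradedOp_gradedPow hX η hΛa r)

end LambdaB

end WeilCohomology

/-! ## The named facts -/

section Facts

variable {k : Type u} [Field k] {K : Type v} [Field K] [CharZero K]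
variable {W : WeilCohomology k K} {n : ℕ} {X : SchemeOver k} {η : W.obj X 2}

/-- **hodge.S29, `B(X) ⇔ Λ algebraic`** — discharge of the named fact
`standardConjectureB_iff_standardConjectureBΛ` (Kleiman 1968 Prop. 2.3; Kleiman 1994 Thm 4-1):
under hard Lefschetz, for `X` smooth projective of dimension `n` with hyperplane class `η`, the
`θ`-form of `B(X, η)` (the inverses of the `Lⁿ⁻ⁱ` are algebraic) is equivalent to the `Λ`-form
(Kleiman's `Λ` is algebraic): `WeilCohomology.standardConjectureBΛ_of_standardConjectureB` and
`WeilCohomology.standardConjectureB_of_standardConjectureBΛ`. [cite: Kleiman1968AlgebraicCycles, §2 Prop. 2.3] -/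
theorem standardConjectureB_iff_standardConjectureBΛ_holds :
    standardConjectureB_iff_standardConjectureBΛ (W := W) (n := n) (X := X) (η := η) :=
  fun hL hX hη ↦ ⟨W.standardConjectureBΛ_of_standardConjectureB hL hX hη,
    W.standardConjectureB_of_standardConjectureBΛ hL hX hη⟩

end Facts

end Literature.AlgebraicGeometry.Motives

end
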